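import Summits.ResolutionOfSingularities.ResolutionOfSingularities.Theorems.WildDescent6
import HarnessLib

/-!
# WildDescent (7/13) — β-descent in a linear frame; §6 FreeChart, part 2: `free_expansion`, `pt_dmap_*`, `free_pts_up`, `free_pts_min`

Verbatim slice of the farm-checked monolith `WildDescent.lean` of cell `decomp-res`, seat `decomp-res-lens-5`, g36
(sha256 4ec0fa6f4f9efba7…); one namespace `Summit.ResolutionOfSingularities.ResolutionOfSingularities.Theorems.WildDescent` across the
slices, imports chained (laws L1–L7 and the mechanism: module docstring of slice 1; main theorems: slice 13/13).
-/

open MvPolynomial Finset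
open scoped BigOperators
open Literature.AlgebraicGeometry.Resolution
open Literature.AlgebraicGeometry.Resolution.Hauser2010
open Literature.AlgebraicGeometry.Resolution.PointBlowup
open Literature.AlgebraicGeometry.Resolution.HauserPerlega2024

namespace Summit.ResolutionOfSingularities.ResolutionOfSingularities.Theorems.WildDescent

section FreeChart

variable {K : Type} [Field K]

/-- **THE EXPANSION (free chart).**  `H(y_f y_k, y_f U, a_l y_f y_l) = Σ_d h_d a_l^{d_f} · y^{D(d)} · U^{d_l}`. [new] -/
theorem free_expansion {f k l : Fin 3} (hfk : f ≠ k) (hfl : f ≠ l) (hkl : k ≠ l) (al β q : K) (H : MvPolynomial (Fin 3) K) :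
    aeval (fun i => if i = k then X f * X k else if i = l then X f * (X l + C β - C q * X k) else X f * (C al * X l)) H =
      ∑ d ∈ H.support, monomial (dmap f k l d) (coeff d H * al ^ (d f)) * (X l + C β - C q * X k) ^ (d l) := by
  rw [MvPolynomial.aeval_eq_eval₂Hom, coe_eval₂Hom, eval₂_eq']
  refine Finset.sum_congr rfl fun d _ => ?_
  rw [prod_three hfk hfl hkl, if_neg hfk, if_neg hfl, if_pos rfl, if_neg hkl.symm, if_pos rfl, monomial_dmap,
    degree_eq_three hfk hfl hkl (fin3_exhaust hfk hfl hkl) d, algebraMap_eq, map_mul, map_pow]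
  simp only [mul_pow]
  ring

/-- Coefficients of `H'` are those of `y_f^s H'` shifted. [folklore] -/
theorem coeff_eq_coeff_X_pow_mul {σ : Type*} (f : σ) (s : ℕ) (P : MvPolynomial σ K) (D : σ →₀ ℕ) :
    coeff D P = coeff (D + Finsupp.single f s) (X f ^ s * P) := by
  classical
  rw [X_pow_eq_monomial, coeff_monomial_mul', if_pos le_add_self, one_mul, add_tsub_cancel_right]

/-- The point of a transported monomial `y^{D}`, `D + s e_f = D(d) + e` (`e` `f`-free), in the NEW frame (free `y_l`, slots
`(k, f)`) dominates `Φ` of the point of `y^d` in the old frame (slots `(k, l)`). [cite: CossartJannsenSaito2020, (12.4) p.134] -/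
theorem pt_dmap_le {f k l : Fin 3} (hfk : f ≠ k) (hfl : f ≠ l) (hkl : k ≠ l) {s : ℕ} {d e D : Fin 3 →₀ ℕ}
    (hsd : s ≤ d.degree) (hef : e f = 0) (hD : D + Finsupp.single f s = dmap f k l d + e) (hDl : D l < s) :
    (phi (pt s f k l d)).1 ≤ (pt s l k f D).1 ∧ (phi (pt s f k l d)).2 ≤ (pt s l k f D).2 := by
  have hk : D k = d k + e k := by
    simpa [Finsupp.single_apply, hfk.symm, dmap_apply_k hfk hkl] using DFunLike.congr_fun hD k
  have hl : D l = d f + e l := by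
    simpa [Finsupp.single_apply, hfl.symm, dmap_apply_l hfl hkl] using DFunLike.congr_fun hD l
  have hf : D f + s = d.degree := by
    simpa [Finsupp.single_apply, dmap_apply_f hfk hfl, hef] using DFunLike.congr_fun hD f
  have hdeg := degree_eq_three hfk hfl hkl (fin3_exhaust hfk hfl hkl) d
  simp only [phi, pt]
  have hdf : d f < s := by omega
  rw [Nat.cast_sub hdf.le, Nat.cast_sub hDl.le, hk, hl]
  push_cast
  have ht : (0 : ℚ) < (s : ℚ) - (d f : ℚ) := by
    have : ((d f : ℕ) : ℚ) < (s : ℚ) := by exact_mod_cast hdf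
    linarith
  have ht' : (0 : ℚ) < (s : ℚ) - ((d f : ℚ) + (e l : ℚ)) := by
    have : ((d f : ℕ) : ℚ) + ((e l : ℕ) : ℚ) < (s : ℚ) := by exact_mod_cast (hl ▸ hDl)
    linarith
  have hek : (0 : ℚ) ≤ (e k : ℚ) := by positivity
  have hel : (0 : ℚ) ≤ (e l : ℚ) := by positivity
  have hdk : (0 : ℚ) ≤ (d k : ℚ) := by positivity
  have hDf : ((D f : ℕ) : ℚ) = (d f : ℚ) + (d k : ℚ) + (d l : ℚ) - (s : ℚ) := by
    have : (D f : ℚ) + (s : ℚ) = ((d.degree : ℕ) : ℚ) := by exact_mod_cast hf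
    rw [hdeg] at this; push_cast at this; linarith
  constructor
  · rw [div_le_div_iff₀ ht ht']; nlinarith
  · rw [hDf, ← add_div, div_sub_one (ne_of_gt ht), div_le_div_iff₀ ht ht']
    have h0 : (0 : ℚ) ≤ (d k : ℚ) + (d l : ℚ) - ((s : ℚ) - (d f : ℚ)) := by
      have : ((s : ℕ) : ℚ) ≤ ((d.degree : ℕ) : ℚ) := by exact_mod_cast hsd
      rw [hdeg] at this; push_cast at this; linarith
    nlinarith

/-- … and differs from it unless `e = 0`. [cite: CossartJannsenSaito2020, (12.4) p.134] -/
theorem pt_dmap_ne {f k l : Fin 3} (hfk : f ≠ k) (hfl : f ≠ l) (hkl : k ≠ l) {s : ℕ} {d e D : Fin 3 →₀ ℕ}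
    (hsd : s ≤ d.degree) (hef : e f = 0) (hD : D + Finsupp.single f s = dmap f k l d + e) (hDl : D l < s)
    (he : e ≠ 0) (hdeg : d.degree = s → e = 0) : phi (pt s f k l d) ≠ pt s l k f D := by
  have hk : D k = d k + e k := by
    simpa [Finsupp.single_apply, hfk.symm, dmap_apply_k hfk hkl] using DFunLike.congr_fun hD k
  have hl : D l = d f + e l := by
    simpa [Finsupp.single_apply, hfl.symm, dmap_apply_l hfl hkl] using DFunLike.congr_fun hD l
  have hf : D f + s = d.degree := by
    simpa [Finsupp.single_apply, dmap_apply_f hfk hfl, hef] using DFunLike.congr_fun hD f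
  have hdeg3 := degree_eq_three hfk hfl hkl (fin3_exhaust hfk hfl hkl) d
  have hdf : d f < s := by omega
  have ht : (0 : ℚ) < (s : ℚ) - (d f : ℚ) := by
    have : ((d f : ℕ) : ℚ) < (s : ℚ) := by exact_mod_cast hdf
    linarith
  have ht' : (0 : ℚ) < (s : ℚ) - ((d f : ℚ) + (e l : ℚ)) := by
    have : ((d f : ℕ) : ℚ) + ((e l : ℕ) : ℚ) < (s : ℚ) := by exact_mod_cast (hl ▸ hDl)
    linarith
  intro heq
  have h1 := congrArg Prod.fst heq
  have h2 := congrArg Prod.snd heq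
  simp only [phi, pt] at h1 h2
  rw [Nat.cast_sub hdf.le, Nat.cast_sub hDl.le, hk, hl] at h1
  rw [Nat.cast_sub hdf.le, Nat.cast_sub hDl.le, hl] at h2
  push_cast at h1 h2
  by_cases hel : e l = 0
  · -- then `e k ≠ 0` and the first coordinates differ
    have hek : e k ≠ 0 := by
      intro hek; apply he; ext i
      rcases fin3_exhaust hfk hfl hkl i with rfl | rfl | rfl
      · exact hef
      · exact hek
      · exact hel
    rw [hel, Nat.cast_zero, add_zero, div_left_inj' (ne_of_gt ht)] at h1
    have : ((d k : ℕ) : ℚ) + ((e k : ℕ) : ℚ) = (d k : ℚ) := by exact_mod_cast h1.symm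
    have hpos : (0 : ℚ) < ((e k : ℕ) : ℚ) := by exact_mod_cast Nat.pos_of_ne_zero hek
    linarith
  · -- then `|d| > s` and the second coordinates differ
    have hds : s < d.degree := by
      rcases (Nat.lt_or_ge s d.degree) with h | h
      · exact h
      · exact absurd (hdeg (le_antisymm h hsd)) he
    have hDf : ((D f : ℕ) : ℚ) = (d f : ℚ) + (d k : ℚ) + (d l : ℚ) - (s : ℚ) := by
      have : (D f : ℚ) + (s : ℚ) = ((d.degree : ℕ) : ℚ) := by exact_mod_cast hf
      rw [hdeg3] at this; push_cast at this; linarith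
    rw [hDf, ← add_div, div_sub_one (ne_of_gt ht)] at h2
    have hnum : (0 : ℚ) < (d k : ℚ) + (d l : ℚ) - ((s : ℚ) - (d f : ℚ)) := by
      have : ((s : ℕ) : ℚ) < ((d.degree : ℕ) : ℚ) := by exact_mod_cast hds
      rw [hdeg3] at this; push_cast at this; linarith
    have hel' : (0 : ℚ) < ((e l : ℕ) : ℚ) := by exact_mod_cast Nat.pos_of_ne_zero hel
    rw [div_eq_div_iff (ne_of_gt ht) (ne_of_gt ht')] at h2
    nlinarith

/-- The main term `e = 0`: the point of `y^{D(d) − s e_f}` in the new frame IS `Φ` of the old point. [new] -/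
theorem pt_dmap_eq {f k l : Fin 3} (hfk : f ≠ k) (hfl : f ≠ l) (hkl : k ≠ l) {s : ℕ} {d D : Fin 3 →₀ ℕ}
    (hD : D + Finsupp.single f s = dmap f k l d) (hDl : D l < s) :
    pt s l k f D = phi (pt s f k l d) := by
  have hk : D k = d k := by
    simpa [Finsupp.single_apply, hfk.symm, dmap_apply_k hfk hkl] using DFunLike.congr_fun hD k
  have hl : D l = d f := by
    simpa [Finsupp.single_apply, hfl.symm, dmap_apply_l hfl hkl] using DFunLike.congr_fun hD l
  have hf : D f + s = d.degree := by
    simpa [Finsupp.single_apply, dmap_apply_f hfk hfl] using DFunLike.congr_fun hD f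
  have hdeg3 := degree_eq_three hfk hfl hkl (fin3_exhaust hfk hfl hkl) d
  have hdf : d f < s := by omega
  have ht : (0 : ℚ) < (s : ℚ) - (d f : ℚ) := by
    have : ((d f : ℕ) : ℚ) < (s : ℚ) := by exact_mod_cast hdf
    linarith
  have hDf : ((D f : ℕ) : ℚ) = (d f : ℚ) + (d k : ℚ) + (d l : ℚ) - (s : ℚ) := by
    have : (D f : ℚ) + (s : ℚ) = ((d.degree : ℕ) : ℚ) := by exact_mod_cast hf
    rw [hdeg3] at this; push_cast at this; linarith
  simp only [phi, pt]
  rw [Nat.cast_sub hdf.le, Nat.cast_sub hDl.le, hk, hl, hDf, ← add_div, div_sub_one (ne_of_gt ht)]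
  congr 1
  ring

/-- **POINT LAW (free chart), upper part: `Δ' ⊆ ↑Φ(Δ)`.**  Every point of the new frame dominates the `Φ`-image of an
old point. [cite: CossartJannsenSaito2020, Lemma 12.1/(12.4) pp.132–134] -/
theorem free_pts_up {f k l : Fin 3} (hfk : f ≠ k) (hfl : f ≠ l) (hkl : k ≠ l) {s : ℕ} {H Hn : MvPolynomial (Fin 3) K}
    (hord : (s : ℕ∞) ≤ ordZero H) {al β q : K}
    (hHn : X f ^ s * Hn = ∑ d ∈ H.support, monomial (dmap f k l d) (coeff d H * al ^ (d f)) * (X l + C β - C q * X k) ^ (d l)) :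
    ∀ x ∈ pts s l k f Hn, ∃ y ∈ (pts s f k l H).image phi, y.1 ≤ x.1 ∧ y.2 ≤ x.2 := by
  classical
  intro x hx
  obtain ⟨D, hD, hDl, rfl⟩ := mem_pts.mp hx
  have hU : ∀ μ ∈ (X l + C β - C q * X k : MvPolynomial (Fin 3) K).support, μ f = 0 :=
    WallFrames.varFree_sub (WallFrames.varFree_add (WallFrames.varFree_X_of_ne (Ne.symm hfl)) (WallFrames.varFree_C f β))
      (WallFrames.varFree_mul (WallFrames.varFree_C f q) (WallFrames.varFree_X_of_ne (Ne.symm hfk)))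
  have hc := mem_support_iff.mp hD
  rw [coeff_eq_coeff_X_pow_mul f s, hHn, coeff_sum] at hc
  obtain ⟨d, hd, hne⟩ := Finset.exists_ne_zero_of_sum_ne_zero hc
  rw [coeff_monomial_mul'] at hne
  split_ifs at hne with hle
  · set e := D + Finsupp.single f s - dmap f k l d with he
    have hecoeff : coeff e ((X l + C β - C q * X k) ^ d l) ≠ 0 := fun h0 => hne (by rw [h0, mul_zero])
    have hef : e f = 0 := varFree_pow hU (d l) e (mem_support_iff.mpr hecoeff)
    have hDe : D + Finsupp.single f s = dmap f k l d + e := by rw [he, add_tsub_cancel_of_le hle]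
    have hsd := le_degree_of_mem_support hord hd
    have hdf : d f < s := by
      have := hle l
      rw [Finsupp.add_apply, Finsupp.single_apply, if_neg hfl, add_zero, dmap_apply_l hfl hkl] at this
      omega
    exact ⟨phi (pt s f k l d), Finset.mem_image_of_mem _ (pt_mem_pts hd hdf), pt_dmap_le hfk hfl hkl hsd hef hDe hDl⟩
  · exact absurd rfl hne

/-- **POINT LAW (free chart), lower part: every Pareto-minimal point of `Φ(Δ)` — in particular its lex-minimum — is a
point of the new frame** (its monomial `h_d a_l^{d_f} β^{d_l} y^{D(d) − s e_f}` is not cancelled).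
[cite: CossartJannsenSaito2020, Lemma 12.1 p.132 ("vertices survive")] -/
theorem free_pts_min {f k l : Fin 3} (hfk : f ≠ k) (hfl : f ≠ l) (hkl : k ≠ l) {s : ℕ} {H Hn : MvPolynomial (Fin 3) K}
    {c : K} (hin : homogeneousComponent s H = C c * X f ^ s) (hord : (s : ℕ∞) ≤ ordZero H) {al β q : K} (hal : al ≠ 0)
    (hβ : β ≠ 0)
    (hHn : X f ^ s * Hn = ∑ d ∈ H.support, monomial (dmap f k l d) (coeff d H * al ^ (d f)) * (X l + C β - C q * X k) ^ (d l))
    {w : ℚ × ℚ} (hw : w ∈ (pts s f k l H).image phi)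
    (hmin : ∀ z ∈ (pts s f k l H).image phi, z.1 ≤ w.1 → z.2 ≤ w.2 → z = w) : w ∈ pts s l k f Hn := by
  classical
  have hU : ∀ μ ∈ (X l + C β - C q * X k : MvPolynomial (Fin 3) K).support, μ f = 0 :=
    WallFrames.varFree_sub (WallFrames.varFree_add (WallFrames.varFree_X_of_ne (Ne.symm hfl)) (WallFrames.varFree_C f β))
      (WallFrames.varFree_mul (WallFrames.varFree_C f q) (WallFrames.varFree_X_of_ne (Ne.symm hfk)))
  obtain ⟨x, hx, rfl⟩ := Finset.mem_image.mp hw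
  obtain ⟨d₀, hd₀, hd₀f, rfl⟩ := mem_pts.mp hx
  have hsd₀ := le_degree_of_mem_support hord hd₀
  -- the main monomial `M = D(d₀) − s e_f`
  have hsle : Finsupp.single f s ≤ dmap f k l d₀ := by
    rw [Finsupp.single_le_iff, dmap_apply_f hfk hfl]; exact hsd₀
  set M := dmap f k l d₀ - Finsupp.single f s with hM
  have hMD : M + Finsupp.single f s = dmap f k l d₀ := tsub_add_cancel_of_le hsle
  have hMl : M l < s := by
    rw [hM, Finsupp.tsub_apply, Finsupp.single_apply, if_neg hfl, Nat.sub_zero, dmap_apply_l hfl hkl]; exact hd₀f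
  refine mem_pts.mpr ⟨M, ?_, hMl, pt_dmap_eq hfk hfl hkl hMD hMl⟩
  rw [mem_support_iff, coeff_eq_coeff_X_pow_mul f s, hMD, hHn, coeff_sum]
  rw [Finset.sum_eq_single_of_mem d₀ hd₀]
  · rw [coeff_monomial_mul', if_pos le_rfl, tsub_self, ← constantCoeff_eq, map_pow, map_sub, map_add, constantCoeff_X,
      constantCoeff_C, map_mul, constantCoeff_C, constantCoeff_X, mul_zero, sub_zero, zero_add]
    exact mul_ne_zero (mul_ne_zero (mem_support_iff.mp hd₀) (pow_ne_zero _ hal)) (pow_ne_zero _ hβ)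
  · intro d hd hne
    rw [coeff_monomial_mul']
    split_ifs with hle
    · -- a competing term would put a point of `Φ(Δ)` strictly below `w`
      by_contra hne0
      set e := dmap f k l d₀ - dmap f k l d with he
      have hecoeff : coeff e ((X l + C β - C q * X k) ^ d l) ≠ 0 := fun h0 => hne0 (by rw [h0, mul_zero])
      have hef : e f = 0 := varFree_pow hU (d l) e (mem_support_iff.mpr hecoeff)
      have hDe : M + Finsupp.single f s = dmap f k l d + e := by rw [hMD, he, add_tsub_cancel_of_le hle]
      have hsd := le_degree_of_mem_support hord hd
      have he0 : e ≠ 0 := by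
        intro h0
        rw [h0, add_zero] at hDe
        exact hne (dmap_injective hfk hfl hkl (hMD.symm.trans hDe).symm)
      have hdeg : d.degree = s → e = 0 := by
        intro hds
        have hd1 := eq_single_of_degree_eq hin hd hds
        have : d l = 0 := by rw [hd1, Finsupp.single_apply, if_neg hfl]
        rw [this, pow_zero, ← C_1] at hecoeff
        rw [coeff_C] at hecoeff
        split_ifs at hecoeff with h0
        · exact h0.symm
        · exact absurd rfl hecoeff
      have hdf : d f < s := by
        have := hle l
        rw [dmap_apply_l hfl hkl, dmap_apply_l hfl hkl] at this
        omega
      have hz : phi (pt s f k l d) ∈ (pts s f k l H).image phi := Finset.mem_image_of_mem _ (pt_mem_pts hd hdf)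
      have hle2 := pt_dmap_le hfk hfl hkl hsd hef hDe hMl
      rw [pt_dmap_eq hfk hfl hkl hMD hMl] at hle2
      have heq := hmin _ hz hle2.1 hle2.2
      rw [← pt_dmap_eq hfk hfl hkl hMD hMl] at heq
      exact pt_dmap_ne hfk hfl hkl hsd hef hDe hMl he0 hdeg heq
    · rfl

/-- A lex-minimum is Pareto-minimal. [folklore] -/
theorem eq_lexMin_of_le {S : Finset (ℚ × ℚ)} {z : ℚ × ℚ} (hz : z ∈ S) (h1 : z.1 ≤ (lexMin S).1) (h2 : z.2 ≤ (lexMin S).2) :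
    z = lexMin S := by
  have hle : toLex z ≤ toLex (lexMin S) := toLex_le_of_le h1 h2
  have hge : toLex (lexMin S) ≤ toLex z := lexMin_le hz
  exact toLex.injective (le_antisymm hle hge)

end FreeChart

end Summit.ResolutionOfSingularities.ResolutionOfSingularities.Theorems.WildDescent
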